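import Summits.CriticalPhenomena.PercolationContinuityZ3.Theorems.PercNearOneGluingNoHeavyLowerTailKnQuestion8CoefficientwiseVremOneSum
import HarnessLib

/-!
# Source-edge deletion monotonicity (VD) inside target-free pockets — prim-lf-2 gen 68

Support file (`--supports stmt-CriticalPhenomena-4575`, closed), prover `prim-lf-2` (gen 68).  No definitions, no named facts, no sorries; standard axioms.
Memo `prim-lf-2/CW-SUBROWS-gen68.md` §4; companion of `…CoefficientwiseRemDecoration.lean` ((PD) inside target-free pockets) and `…CoefficientwiseVremOneSum.lean`.

Setting (gen 67 `…CoefficientwisePointRowSourceDeletion.lean`): `VREM_F(x,a,W)[g] := Σ_{s ⊆ F : a ∈ C_x s, ∀ w∈W ¬(w ∈ C_x s ∧ w ∈ C_x(F∖s))} (g(C_x s) − g(C_x(F∖s)))`;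
CONJECTURE (VD) (prim-lf-2 gen 67): `VREM_{F.erase h} ≤ VREM_F` for every edge `h` at the source `a` (exact-clean n ≤ 7, n = 8 m ≤ 9; the contraction analogue is false).
For a TARGET-FREE pocket `D` hung at a vertex `u` (the source `a` and the root on `D`-edges only if equal to `u`), `vrem_oneSum_eq` with `W₂ = ∅` is the pocket identity
`VREM_{E∪D}[g] = Σ_{t⊆D} VREM_E[g_t]`, `g_t(X) = g(X ∪ [u∈X]·C_u(t))`; hence:
* `Coefficientwise.vrem_sub_vrem_erase_eq_of_decoration` — for `f ∈ D`: `VREM_{E∪D}[g] − VREM_{E∪(D.erase f)}[g] = Σ_{t ⊆ D.erase f} VREM_E[g_{insert f t}]`;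
* `Coefficientwise.vrem_erase_le_of_decoration` — **(VD) for every edge of a target-free pocket** (hung at the source `a = u`, or anywhere): `VREM_{E∪(D.erase f)} ≤ VREM_{E∪D}`
  whenever `VREM_E(x,a,W)[φ] ≥ 0` for all monotone `φ` — the first proved cases of (VD) (e.g. `h = ab` with `b` pendant, or `b` in a target-free subgraph attached only at `a`).
[cite: KozmaNitzan2024, Questions 8–9 (§5.5 p. 36) (context: the Question-8 pocket covariance programme)]
-/

namespace Summit.CriticalPhenomena.PercolationContinuityZ3.Theorems

open Finset Literature.Probability.Percolation

namespace Coefficientwise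

variable {ι V : Type*} [DecidableEq ι]

open Classical in
/-- **(VD) inside a pocket — the identity.**  Let `E, D` be disjoint edge sets of `ends : ι → Sym2 V` meeting only at `u`, the root `x` and the source `a` on `D`-edges only if
equal to `u`, the targets `W` on `D`-edges only if equal to `u` (target-free pocket), `f ∈ D`.  Then
`VREM_{E∪D}(x,a,W)[g] − VREM_{E∪(D.erase f)}(x,a,W)[g] = Σ_{t ⊆ D.erase f} VREM_E(x,a,W)[X ↦ g(X ∪ {y | u ∈ X ∧ y ∈ C_u(insert f t)})]`.
[cite: KozmaNitzan2024, Questions 8–9 (§5.5 p. 36) (context)] -/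
theorem vrem_sub_vrem_erase_eq_of_decoration (ends : ι → Sym2 V) {E D : Finset ι} (hED : Disjoint E D) {x u a : V}
    (ha : ∀ e' ∈ D, a ∈ ends e' → a = u)
    (hsep : ∀ e₁ ∈ E, ∀ e' ∈ D, ∀ w : V, w ∈ ends e₁ → w ∈ ends e' → w = u)
    (hx : ∀ e' ∈ D, x ∈ ends e' → x = u) (W : Set V) (hW : ∀ e' ∈ D, ∀ w ∈ W, w ∈ ends e' → w = u) (g : Set V → ℝ)
    {f : ι} (hf : f ∈ D) :
    (∑ r ∈ (E ∪ D).powerset.filter (fun r : Finset ι => a ∈ openCluster (ends '' (↑r : Set ι)) x ∧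
          ∀ w ∈ W, ¬ (w ∈ openCluster (ends '' (↑r : Set ι)) x ∧ w ∈ openCluster (ends '' (↑((E ∪ D) \ r) : Set ι)) x)),
      (g (openCluster (ends '' (↑r : Set ι)) x) - g (openCluster (ends '' (↑((E ∪ D) \ r) : Set ι)) x))) -
    (∑ r ∈ (E ∪ D.erase f).powerset.filter (fun r : Finset ι => a ∈ openCluster (ends '' (↑r : Set ι)) x ∧
          ∀ w ∈ W, ¬ (w ∈ openCluster (ends '' (↑r : Set ι)) x ∧ w ∈ openCluster (ends '' (↑((E ∪ D.erase f) \ r) : Set ι)) x)),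
      (g (openCluster (ends '' (↑r : Set ι)) x) - g (openCluster (ends '' (↑((E ∪ D.erase f) \ r) : Set ι)) x))) =
    ∑ t ∈ (D.erase f).powerset, ∑ s ∈ E.powerset.filter (fun s : Finset ι => a ∈ openCluster (ends '' (↑s : Set ι)) x ∧
          ∀ w ∈ W, ¬ (w ∈ openCluster (ends '' (↑s : Set ι)) x ∧ w ∈ openCluster (ends '' (↑(E \ s) : Set ι)) x)),
      (g (openCluster (ends '' (↑s : Set ι)) x ∪ {y | u ∈ openCluster (ends '' (↑s : Set ι)) x ∧ y ∈ openCluster (ends '' (↑(insert f t) : Set ι)) u}) -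
        g (openCluster (ends '' (↑(E \ s) : Set ι)) x ∪
          {y | u ∈ openCluster (ends '' (↑(E \ s) : Set ι)) x ∧ y ∈ openCluster (ends '' (↑(insert f t) : Set ι)) u})) := by
  have hED' : Disjoint E (D.erase f) := Finset.disjoint_of_subset_right (Finset.erase_subset f D) hED
  have ha' : ∀ e' ∈ D.erase f, a ∈ ends e' → a = u := fun e' he' hae => ha e' (Finset.mem_of_mem_erase he') hae
  have hsep' : ∀ e₁ ∈ E, ∀ e' ∈ D.erase f, ∀ w : V, w ∈ ends e₁ → w ∈ ends e' → w = u :=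
    fun e₁ he₁ e' he' w hw hw' => hsep e₁ he₁ e' (Finset.mem_of_mem_erase he') w hw hw'
  have hx' : ∀ e' ∈ D.erase f, x ∈ ends e' → x = u := fun e' he' hxe => hx e' (Finset.mem_of_mem_erase he') hxe
  have hW' : ∀ e' ∈ D.erase f, ∀ w ∈ W, w ∈ ends e' → w = u := fun e' he' w hw hwe => hW e' (Finset.mem_of_mem_erase he') w hw hwe
  -- the target-free pocket identity is `vrem_oneSum_eq` with `W₂ = ∅`
  have hWe : W = W ∪ (∅ : Set V) := by rw [Set.union_empty]
  have hW₂ : ∀ e₁ ∈ E, ∀ w ∈ (∅ : Set V), w ∉ ends e₁ := fun _ _ w hw => absurd hw (Set.notMem_empty w)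
  have hxW₂ : x ∉ (∅ : Set V) := Set.notMem_empty x
  have h1 := vrem_oneSum_eq ends hED ha hsep hx W ∅ hW hW₂ hxW₂ g
  have h2 := vrem_oneSum_eq ends hED' ha' hsep' hx' W ∅ hW' hW₂ hxW₂ g
  rw [← hWe] at h1 h2
  rw [h1, h2]
  have htriv : ∀ (D' : Finset ι) (t : Finset ι), (∀ w ∈ (∅ : Set V), ¬ (w ∈ openCluster (ends '' (↑t : Set ι)) u ∧
      w ∈ openCluster (ends '' (↑(D' \ t) : Set ι)) u)) := fun D' t w hw => absurd hw (Set.notMem_empty w)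
  simp only [if_pos (htriv _ _)]
  set D' : Finset ι := D.erase f with hD'
  have hD : D = insert f D' := by rw [hD', Finset.insert_erase hf]
  have hfD : f ∉ D' := by rw [hD']; exact Finset.notMem_erase f D
  have hpow : D.powerset = (insert f D').powerset := by rw [← hD]
  rw [hpow, Finset.sum_powerset_insert hfD]
  ring

open Classical in
/-- **(VD) for every edge of a target-free pocket (conditional form).**  Under the hypotheses of `vrem_sub_vrem_erase_eq_of_decoration`, if `VREM_E(x,a,W)[φ] ≥ 0` for every
monotone `φ`, then for every monotone `g` and `f ∈ D`: `VREM_{E∪(D.erase f)}(x,a,W)[g] ≤ VREM_{E∪D}(x,a,W)[g]` — deleting an edge of a target-free pocket hung at the source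
(or anywhere off the targets) does not increase the point row.  [cite: KozmaNitzan2024, Questions 8–9 (§5.5 p. 36) (context)] -/
theorem vrem_erase_le_of_decoration (ends : ι → Sym2 V) {E D : Finset ι} (hED : Disjoint E D) {x u a : V}
    (ha : ∀ e' ∈ D, a ∈ ends e' → a = u)
    (hsep : ∀ e₁ ∈ E, ∀ e' ∈ D, ∀ w : V, w ∈ ends e₁ → w ∈ ends e' → w = u)
    (hx : ∀ e' ∈ D, x ∈ ends e' → x = u) (W : Set V) (hW : ∀ e' ∈ D, ∀ w ∈ W, w ∈ ends e' → w = u)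
    (h : ∀ φ : Set V → ℝ, Monotone φ →
      0 ≤ ∑ s ∈ E.powerset.filter (fun s : Finset ι => a ∈ openCluster (ends '' (↑s : Set ι)) x ∧
            ∀ w ∈ W, ¬ (w ∈ openCluster (ends '' (↑s : Set ι)) x ∧ w ∈ openCluster (ends '' (↑(E \ s) : Set ι)) x)),
        (φ (openCluster (ends '' (↑s : Set ι)) x) - φ (openCluster (ends '' (↑(E \ s) : Set ι)) x)))
    (g : Set V → ℝ) (hg : Monotone g) {f : ι} (hf : f ∈ D) :
    ∑ r ∈ (E ∪ D.erase f).powerset.filter (fun r : Finset ι => a ∈ openCluster (ends '' (↑r : Set ι)) x ∧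
          ∀ w ∈ W, ¬ (w ∈ openCluster (ends '' (↑r : Set ι)) x ∧ w ∈ openCluster (ends '' (↑((E ∪ D.erase f) \ r) : Set ι)) x)),
      (g (openCluster (ends '' (↑r : Set ι)) x) - g (openCluster (ends '' (↑((E ∪ D.erase f) \ r) : Set ι)) x)) ≤
    ∑ r ∈ (E ∪ D).powerset.filter (fun r : Finset ι => a ∈ openCluster (ends '' (↑r : Set ι)) x ∧
          ∀ w ∈ W, ¬ (w ∈ openCluster (ends '' (↑r : Set ι)) x ∧ w ∈ openCluster (ends '' (↑((E ∪ D) \ r) : Set ι)) x)),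
      (g (openCluster (ends '' (↑r : Set ι)) x) - g (openCluster (ends '' (↑((E ∪ D) \ r) : Set ι)) x)) := by
  rw [← sub_nonneg, vrem_sub_vrem_erase_eq_of_decoration ends hED ha hsep hx W hW g hf]
  refine Finset.sum_nonneg fun t _ => ?_
  refine h (fun X => g (X ∪ {y | u ∈ X ∧ y ∈ openCluster (ends '' (↑(insert f t) : Set ι)) u})) ?_
  intro X X' hXX'
  refine hg (Set.union_subset_union hXX' ?_)
  intro y hy
  exact ⟨hXX' hy.1, hy.2⟩

end Coefficientwise

end Summit.CriticalPhenomena.PercolationContinuityZ3.Theorems
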